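import Mathlib
import Summits.Ventures.PercRepro2.SwOutAll
import Summits.Ventures.PercRepro2.SwOutSeriesDefs

/-!
# Cyclic regions, part 1: vocabulary and bookkeeping (blind cell PercRepro2, night-4 g10,
2026-08-25; proofs/NIGHT4-G10.md §4, §7)

A region is CYCLIC (`CyclicRegion`) when every vertex of `U` other than `h, o` either carries an
edge to the outside or is a PATH VERTEX: all its edges have both ends in `U` and it has at most two
edges.  Cycle regions through `h` (wheels, fans, cycle + apex), path regions, and any such region
with pendant paths are cyclic.  **`reducible_of_cyclicRegion`**: every cyclic region is series-
reducible (induction on the number of edges at vertices without outside edges plus loops at `h`: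
a loop is parked, a path vertex with one edge is peeled, with two edges contracted / deleted, and
when nothing is left the arm principle is the base).  **`sw_of_cyclic`**: row (SW) on every graph
whose region `V ∖ {l}` is cyclic — every graph in which every vertex other than `l, h, o` not
joined to `l` has at most two edges, e.g. `G − l` a cycle through `h`.
-/

namespace Summit.Ventures.PercRepro2

namespace LocRows

open Hull

variable {V : Type*} {E : Type*} [Fintype E] [DecidableEq E]

open scoped Classical

variable (ends : E → Sym2 V) (l h o : V)

/-- The edges at `x`. -/
noncomputable def edgesAt (x : V) : Finset E := Finset.univ.filter fun e => x ∈ ends e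

/-- `x` has an edge to the outside of `U`. -/
def HasOut (U : Set V) (x : V) : Prop := ∃ e y, ends e = s(x, y) ∧ y ∉ U

/-- A CYCLIC region: every vertex other than `h, o` has an outside edge or is a path vertex. -/
def CyclicRegion (U : Set V) : Prop :=
  ∀ x ∈ U, x ≠ h → x ≠ o → HasOut ends U x ∨
    ((∀ e, x ∈ ends e → ∀ y ∈ ends e, y ∈ U) ∧ (edgesAt ends x).card ≤ 2)

/-- The BAD edges: the edges at a non-mark vertex of `U` without outside edge, and the loops at `h`. -/
noncomputable def badEdges (U : Set V) : Finset E :=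
  Finset.univ.filter fun e =>
    (∃ x ∈ ends e, x ∈ U ∧ x ≠ h ∧ x ≠ o ∧ ¬ HasOut ends U x) ∨ ends e = s(h, h)

variable {ends l h o}

omit [DecidableEq E] in
/-- Membership in `edgesAt`. -/
lemma mem_edgesAt {x : V} {e : E} : e ∈ edgesAt ends x ↔ x ∈ ends e := by
  simp [edgesAt]

omit [DecidableEq E] in
/-- Membership in `badEdges`. -/
lemma mem_badEdges {U : Set V} {e : E} :
    e ∈ badEdges ends h o U ↔
      (∃ x ∈ ends e, x ∈ U ∧ x ≠ h ∧ x ≠ o ∧ ¬ HasOut ends U x) ∨ ends e = s(h, h) := by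
  simp only [badEdges, Finset.mem_filter, Finset.mem_univ, true_and]

section Induction

variable {U : Set V}

omit [Fintype E] [DecidableEq E] in
/-- An edge with both ends in `U` witnesses no outside edge. -/
lemma not_hasOut_of_inside {x : V} (hin : ∀ e, x ∈ ends e → ∀ y ∈ ends e, y ∈ U) :
    ¬ HasOut ends U x := by
  rintro ⟨e, y, hxy, hyU⟩
  exact hyU (hin e (by rw [hxy]; exact Sym2.mem_mk_left x y) y
    (by rw [hxy]; exact Sym2.mem_mk_right x y))

omit [Fintype E] [DecidableEq E] in
/-- Outside edges transfer to a graph agreeing on every edge with an end outside `U`, for a smaller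
region. -/
lemma hasOut_transfer {ends' : E → Sym2 V} {U' : Set V} (hU' : U' ⊆ U)
    (hagree : ∀ e, (∃ z ∈ ends e, z ∉ U) → ends' e = ends e) {y : V} (hy : HasOut ends U y) :
    HasOut ends' U' y := by
  obtain ⟨e, z, hyz, hzU⟩ := hy
  refine ⟨e, z, ?_, fun h' => hzU (hU' h')⟩
  rw [hagree e ⟨z, by rw [hyz]; exact Sym2.mem_mk_right y z, hzU⟩]
  exact hyz

omit [DecidableEq E] in
/-- Bad edges transfer upward for unchanged edges. -/
lemma mem_badEdges_of_agree {ends' : E → Sym2 V} {U' : Set V} (hU' : U' ⊆ U)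
    (hout : ∀ y ∈ U', HasOut ends U y → HasOut ends' U' y) {e : E} (he : ends' e = ends e)
    (hbad : e ∈ badEdges ends' h o U') : e ∈ badEdges ends h o U := by
  rw [mem_badEdges] at hbad ⊢
  rw [he] at hbad
  rcases hbad with ⟨y, hy, hyU, hyh, hyo, hyout⟩ | hloop
  · exact Or.inl ⟨y, hy, hU' hyU, hyh, hyo, fun h' => hyout (hout y hyU h')⟩
  · exact Or.inr hloop

/-- The count of bad edges drops when they shrink to a subset of the old ones minus one. -/
lemma card_badEdges_lt {ends' : E → Sym2 V} {U' : Set V} {e₀ : E} (he₀ : e₀ ∈ badEdges ends h o U)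
    (hsub : badEdges ends' h o U' ⊆ (badEdges ends h o U).erase e₀) :
    (badEdges ends' h o U').card < (badEdges ends h o U).card :=
  lt_of_le_of_lt (Finset.card_le_card hsub) (Finset.card_erase_lt_of_mem he₀)

omit [DecidableEq E] in
/-- The edges at a vertex after an operation that only changes edges not at that vertex (in the
new graph) or removes them. -/
lemma edgesAt_subset_of {ends' : E → Sym2 V} {y : V}
    (h : ∀ e, y ∈ ends' e → y ∈ ends e) : edgesAt ends' y ⊆ edgesAt ends y := by
  intro e he
  rw [mem_edgesAt] at he ⊢
  exact h e he


/-- A cyclic region stays cyclic after contracting a series vertex without outside edge. -/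
lemma cyclicRegion_contract {x p q : V} {e₀ e₁ : E} (hcyc : CyclicRegion ends h o U)
    (hne : e₀ ≠ e₁) (hp : ends e₀ = s(x, p)) (hq : ends e₁ = s(x, q)) (hpx : p ≠ x) (hqx : q ≠ x)
    (hpU : p ∈ U) (hqU : q ∈ U) (hin : ∀ e, x ∈ ends e → ∀ y ∈ ends e, y ∈ U)
    (honly : ∀ e, x ∈ ends e → e = e₀ ∨ e = e₁)
    (houtC : ∀ y ∈ U \ {x}, HasOut ends U y → HasOut (contractSeries ends x p q e₀ e₁) (U \ {x}) y) :
    CyclicRegion (contractSeries ends x p q e₀ e₁) h o (U \ {x}) := by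
  intro y hyU hyh hyo
  rcases hcyc y hyU.1 hyh hyo with hout' | ⟨hin', hcard'⟩
  · exact Or.inl (houtC y hyU hout')
  · right
    have hyx : y ≠ x := fun h' => hyU.2 (Set.mem_singleton_iff.2 h')
    -- edges at `y` in the contracted graph
    have hye : ∀ e', y ∈ contractSeries ends x p q e₀ e₁ e' →
        e' ≠ e₀ ∧ (e' = e₁ ∨ y ∈ ends e') := by
      intro e' hy'
      by_cases h₀ : e' = e₀
      · subst h₀
        rw [contractSeries_apply_e₁, Sym2.mem_iff] at hy'
        rcases hy' with rfl | rfl <;> exact absurd rfl hyx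
      by_cases h₁ : e' = e₁
      · exact ⟨h₀, Or.inl h₁⟩
      · rw [contractSeries_apply_of_ne h₀ h₁] at hy'; exact ⟨h₀, Or.inr hy'⟩
    refine ⟨fun e' hy' z hz => ?_, ?_⟩
    · have h₀ : e' ≠ e₀ := (hye e' hy').1
      by_cases h₁ : e' = e₁
      · subst h₁
        rw [contractSeries_apply_e₂ hne, Sym2.mem_iff] at hz
        rcases hz with rfl | rfl
        · exact ⟨hpU, fun h' => hpx (Set.mem_singleton_iff.1 h')⟩
        · exact ⟨hqU, fun h' => hqx (Set.mem_singleton_iff.1 h')⟩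
      · rw [contractSeries_apply_of_ne h₀ h₁] at hy' hz
        refine ⟨hin' e' hy' z hz, ?_⟩
        rintro rfl
        rcases honly e' hz with rfl | rfl
        · exact h₀ rfl
        · exact h₁ rfl
    · -- the count: the contracted edge replaces `e₀` at `p`, or was already at `q`
      by_cases hy₀ : e₀ ∈ edgesAt ends y
      · have hsub : edgesAt (contractSeries ends x p q e₀ e₁) y ⊆
            insert e₁ ((edgesAt ends y).erase e₀) := by
          intro e' he'
          rw [mem_edgesAt] at he'
          obtain ⟨h₀, h₁⟩ := hye e' he'
          rw [Finset.mem_insert, Finset.mem_erase]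
          rcases h₁ with rfl | hy''
          · exact Or.inl rfl
          · exact Or.inr ⟨h₀, mem_edgesAt.2 hy''⟩
        calc (edgesAt (contractSeries ends x p q e₀ e₁) y).card
            ≤ (insert e₁ ((edgesAt ends y).erase e₀)).card := Finset.card_le_card hsub
          _ ≤ ((edgesAt ends y).erase e₀).card + 1 := Finset.card_insert_le _ _
          _ = (edgesAt ends y).card := by
            rw [Finset.card_erase_of_mem hy₀]
            have : 0 < (edgesAt ends y).card := Finset.card_pos.2 ⟨e₀, hy₀⟩
            omega
          _ ≤ 2 := hcard'
      · have hsub : edgesAt (contractSeries ends x p q e₀ e₁) y ⊆ edgesAt ends y := by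
          intro e' he'
          rw [mem_edgesAt] at he' ⊢
          obtain ⟨h₀, h₁⟩ := hye e' he'
          rcases h₁ with rfl | hy''
          · -- `y ∈ s(p, q)`; `y ≠ p` (else `e₀ ∈ edgesAt y`), so `y = q ∈ ends e₁`
            rw [contractSeries_apply_e₂ hne, Sym2.mem_iff] at he'
            rcases he' with rfl | rfl
            · exact absurd (mem_edgesAt.2 (by rw [hp]; exact Sym2.mem_mk_right x y)) hy₀
            · rw [hq]; exact Sym2.mem_mk_right x y
          · exact hy''
        exact (Finset.card_le_card hsub).trans hcard'

/-- A cyclic region stays cyclic after deleting a series vertex without outside edge. -/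
lemma cyclicRegion_delete {x : V} {e₀ e₁ : E} (hcyc : CyclicRegion ends h o U)
    (hne : e₀ ≠ e₁) (hin : ∀ e, x ∈ ends e → ∀ y ∈ ends e, y ∈ U)
    (honly : ∀ e, x ∈ ends e → e = e₀ ∨ e = e₁)
    (houtD : ∀ y ∈ U \ {x}, HasOut ends U y → HasOut (deleteSeries ends x e₀ e₁) (U \ {x}) y) :
    CyclicRegion (deleteSeries ends x e₀ e₁) h o (U \ {x}) := by
  intro y hyU hyh hyo
  rcases hcyc y hyU.1 hyh hyo with hout' | ⟨hin', hcard'⟩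
  · exact Or.inl (houtD y hyU hout')
  · right
    have hyx : y ≠ x := fun h' => hyU.2 (Set.mem_singleton_iff.2 h')
    have hye : ∀ e', y ∈ deleteSeries ends x e₀ e₁ e' → (e' ≠ e₀ ∧ e' ≠ e₁) ∧ y ∈ ends e' := by
      intro e' hy'
      by_cases h₀ : e' = e₀
      · subst h₀
        rw [deleteSeries_apply_e₁, Sym2.mem_iff] at hy'
        rcases hy' with rfl | rfl <;> exact absurd rfl hyx
      by_cases h₁ : e' = e₁
      · subst h₁
        rw [deleteSeries_apply_e₂ hne, Sym2.mem_iff] at hy'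
        rcases hy' with rfl | rfl <;> exact absurd rfl hyx
      · rw [deleteSeries_apply_of_ne h₀ h₁] at hy'; exact ⟨⟨h₀, h₁⟩, hy'⟩
    refine ⟨fun e' hy' z hz => ?_, (Finset.card_le_card
      (edgesAt_subset_of fun e' hy' => (hye e' hy').2)).trans hcard'⟩
    obtain ⟨⟨h₀, h₁⟩, hy''⟩ := hye e' hy'
    rw [deleteSeries_apply_of_ne h₀ h₁] at hz
    refine ⟨hin' e' hy'' z hz, ?_⟩
    rintro rfl
    rcases honly e' hz with rfl | rfl
    · exact h₀ rfl
    · exact h₁ rfl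

end Induction

end LocRows

end Summit.Ventures.PercRepro2
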